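import Summits.AtomisticToContinuum.BoseEinsteinCondensation.Theses.BECInsertionCorrector

/-!
# Sketch — crux idea `rim-squeeze-monotone-coherence` for stmt-AtomisticToContinuum-0827
(`BECInsertionCorrector.BoundaryTransferWeak`, shared by 77 routes; ideator k = 2, round 1)

One-parameter stoquastic family on the A-exact torus of side `L'` (cell `[0,L')³`):
`H_t = H^per + t · Σ_j w(x_j)`, `w = 1_{rim}`, rim `R = {x ∈ cell : ∃ k, L'/2 ≤ x_k}` (the seam layer of
width `L'/2`, i.e. the complement of the cube `Q = (0, L'/2)³`), `t ∈ [0, ∞]`.  `t = 0`: the torus ground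
state at density `ρ' = N/L'³` (where the hypothesis `A = PeriodicBEC(v)` is consumable verbatim);
`t = ⊤`: periodic `C¹` states that vanish whenever a particle sits in the rim = the Dirichlet problem of
the cube `Q` of side `L'/2 = sideLength (8ρ') N` (the conclusion `B` at density `8ρ'`).  The monotone
quantity is the flat-mode occupation of the CORE `C = (L'/8, 3L'/8)³` (middle half of `Q`), defined for
the "ground state of `H_t`" through near-minimisers exactly as `condensateNumber`.
-/

noncomputable section

namespace Summit.AtomisticToContinuum.BoseEinsteinCondensation.Cruxes.BoundaryTransferWeak.RimSqueeze

open Literature.MathematicalPhysics.QuantumManyBody.BoseGas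
open MeasureTheory Filter Set
open scoped ENNReal NNReal ComplexConjugate

/-- The rim (seam layer) of the torus cell `[0,L')³`: some coordinate in `[L'/2, L')`; its complement in
the cell is the cube `[0, L'/2)³`. Value `1` on the rim, `0` elsewhere (bounded one-body potential). -/
def rimPot (L' : ℝ) : Space → ℝ≥0∞ :=
  {x : Space | ∃ k, L' / 2 ≤ x k}.indicator fun _ => 1

/-- The normalised indicator of the core cube `C = (L'/8, 3L'/8)³` (side `L'/4`, the middle half of the
Dirichlet cube `(0, L'/2)³`). -/
def coreMode (L' : ℝ) : Space → ℂ :=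
  {x : Space | ∀ k, x k ∈ Ioo (L' / 8) (3 * L' / 8)}.indicator fun _ => ((Real.sqrt ((L' / 4) ^ 3))⁻¹ : ℂ)

/-- The rim term `t ∫_{cell^N} (Σ_j w(x_j)) |Ψ|²` of the ramp Hamiltonian (for `t = ⊤` it is `0` iff `Ψ`
vanishes a.e. on configurations with a particle in the rim, `⊤` otherwise). -/
def rimEnergy {N : ℕ} {L' : ℝ} (w : Space → ℝ≥0∞) (t : ℝ≥0∞) (Ψ : PeriodicTrialState N L') : ℝ≥0∞ :=
  t * ∫⁻ X in cellN N L', (∑ j, w (X j)) * (‖Ψ.ψ X‖₊ : ℝ≥0∞) ^ 2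

/-- Quadratic form of the ramp Hamiltonian `H_t = H^per + t Σ_j w(x_j)`. -/
def rampEnergy {N : ℕ} {L' : ℝ} (v : ℝ → ℝ≥0∞) (w : Space → ℝ≥0∞) (t : ℝ≥0∞)
    (Ψ : PeriodicTrialState N L') : ℝ≥0∞ :=
  periodicEnergy v Ψ + rimEnergy w t Ψ

/-- Ground-state energy of the ramp Hamiltonian (infimum of the form over the periodic `C¹` core). -/
def rampGroundStateEnergy (v : ℝ → ℝ≥0∞) (w : Space → ℝ≥0∞) (t : ℝ≥0∞) (N : ℕ) (L' : ℝ) : ℝ≥0∞ :=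
  ⨅ Ψ : PeriodicTrialState N L', rampEnergy v w t Ψ

/-- Occupation of a cell mode `φ` in the ground state of `H_t`, through near-minimisers
(`sup_δ inf {⟨φ, γ_Ψ φ⟩ : rampEnergy Ψ ≤ E_t + δ}`, the honest reading as in `condensateNumber`). -/
def rampOccupation (v : ℝ → ℝ≥0∞) (w : Space → ℝ≥0∞) (t : ℝ≥0∞) (N : ℕ) (L' : ℝ) (φ : Space → ℂ) :
    ℝ≥0∞ :=
  ⨆ (δ : ℝ≥0∞) (_ : 0 < δ), ⨅ (Ψ : PeriodicTrialState N L')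
    (_ : rampEnergy v w t Ψ ≤ rampGroundStateEnergy v w t N L' + δ), cellOccupation N L' φ Ψ.ψ

/-- Core flat-mode occupation `⟨χ_C, γ_t χ_C⟩` of the ground state of `H_t` on the torus of density `ρ'`
(side `L' = sideLength ρ' N`), rim = complement of the cube of side `L'/2`, core = its middle half. -/
def coreOcc (v : ℝ → ℝ≥0∞) (t : ℝ≥0∞) (N : ℕ) (ρ' : ℝ) : ℝ≥0∞ :=
  rampOccupation v (rimPot (sideLength ρ' N)) t N (sideLength ρ' N) (coreMode (sideLength ρ' N))

/-- **(M) RIM-SQUEEZE MONOTONICITY** (the conjectural lever): along the ramp `t ∈ [0, ∞]` the core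
flat-mode occupation of the ground state is non-decreasing — "pushing a dilute repulsive Bose gas out of
the rim never lowers the coherence of the core".  The case `t = ⊤` is the Dirichlet cube. -/
def RimSqueezeMonotone : Prop :=
  ∀ v : ℝ → ℝ≥0∞, IsRepulsiveFiniteRange v → ∃ ρ₁ : ℝ, 0 < ρ₁ ∧ ∀ ρ' : ℝ, 0 < ρ' → ρ' < ρ₁ →
    ∀ᶠ N : ℕ in atTop, ∀ s t : ℝ≥0∞, s ≤ t → coreOcc v s N ρ' ≤ coreOcc v t N ρ'

/-- **Torus core floor** (support; where `A` is consumed, once, on exact periodic near-minimisers):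
`A(v)` ⇒ at `t = 0` the core occupation is `≥ (|C|/L'³)·cN = cN/64` eventually (translation invariance
of `γ` for the torus ground state + PSD Cauchy–Schwarz over the 64 translates of `C`; `δ`-erasure
honoured: no slack is quantified). -/
def TorusCoreFloor : Prop :=
  ∀ v : ℝ → ℝ≥0∞, IsRepulsiveFiniteRange v →
    (∃ ρ₀ : ℝ, 0 < ρ₀ ∧ ∀ ρ : ℝ, 0 < ρ → ρ < ρ₀ → ∃ c : ℝ, 0 < c ∧ ∀ᶠ N : ℕ in atTop,
      ∃ δ : ℝ≥0∞, 0 < δ ∧ ∀ Ψ : PeriodicTrialState N (sideLength ρ N),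
        periodicEnergy v Ψ ≤ periodicGroundStateEnergy v N (sideLength ρ N) + δ →
          ENNReal.ofReal (c * N) ≤ condensateOccupation N (sideLength ρ N) Ψ.ψ) →
    ∃ ρ₁ : ℝ, 0 < ρ₁ ∧ ∀ ρ' : ℝ, 0 < ρ' → ρ' < ρ₁ →
      ∃ c : ℝ, 0 < c ∧ ∀ᶠ N : ℕ in atTop, ENNReal.ofReal (c * N) ≤ coreOcc v 0 N ρ'

/-- **Dirichlet endpoint** (support, provable now): at `t = ⊤` the ramp problem IS the Dirichlet
problem of the cube of side `L'/2 = sideLength (8ρ') N` (a periodic `C¹` state with finite `⊤`-rim energy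
vanishes with its gradient on the rim, so its cut-off to the cube is a `TrialState N (L'/2)`, and
conversely), hence a core floor `≥ cN` at `t = ⊤` gives `λ_max ≥ cN` for all Dirichlet near-minimisers
(`occupation_le_maxOccupation`, `le_condensateNumber`), i.e. `HasGroundStateBEC v (8ρ')`. -/
def DirichletEndpoint : Prop :=
  ∀ v : ℝ → ℝ≥0∞, IsRepulsiveFiniteRange v → ∀ ρ' : ℝ, 0 < ρ' →
    (∃ c : ℝ, 0 < c ∧ ∀ᶠ N : ℕ in atTop, ENNReal.ofReal (c * N) ≤ coreOcc v ⊤ N ρ') →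
      HasGroundStateBEC v (8 * ρ')

/-- **First lemma** (the cheap half of the endpoint sandwich, checkable now): for every `t ∈ [0, ∞]` the
ramp ground-state energy lies below the Dirichlet energy of the inner cube — a Dirichlet trial state of
`(0, L'/2)³`, extended periodically, pays no rim term and (once `2R₀ ≤ L'`, no image interactions) has
periodic energy equal to its Dirichlet energy. -/
def RampBelowDirichlet : Prop :=
  ∀ (v : ℝ → ℝ≥0∞) (R₀ : ℝ), (∀ r, R₀ < r → v r = 0) → ∀ (N : ℕ) (L' : ℝ), 0 < L' → 2 * R₀ ≤ L' →
    ∀ t : ℝ≥0∞, rampGroundStateEnergy v (rimPot L') t N L' ≤ groundStateEnergy v N (L' / 2)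

/-- The reduction (kernel-checked glue): `(M)` + the two supports give the crux BY NAME. `A` enters only
through `TorusCoreFloor` at `t = 0`; `(M)` transports the floor to `t = ⊤`; the endpoint turns it into
`HasGroundStateBEC v ρ` with `ρ = 8ρ'`. -/
theorem boundaryTransferWeak_of (hM : RimSqueezeMonotone) (hT : TorusCoreFloor)
    (hD : DirichletEndpoint) : Theses.BECInsertionCorrector.BoundaryTransferWeak := by
  intro v hv hA
  obtain ⟨ρ₁, hρ₁, hM'⟩ := hM v hv
  obtain ⟨ρ₂, hρ₂, hT'⟩ := hT v hv hA
  refine ⟨8 * min ρ₁ ρ₂, by positivity, fun ρ hρ hρlt => ?_⟩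
  have hρ' : 0 < ρ / 8 := by positivity
  have h1 : ρ / 8 < ρ₁ := by
    have := min_le_left ρ₁ ρ₂
    linarith
  have h2 : ρ / 8 < ρ₂ := by
    have := min_le_right ρ₁ ρ₂
    linarith
  obtain ⟨c, hc, hev⟩ := hT' (ρ / 8) hρ' h2
  have key : ∀ᶠ N : ℕ in atTop, ENNReal.ofReal (c * N) ≤ coreOcc v ⊤ N (ρ / 8) :=
    (hev.and (hM' (ρ / 8) hρ' h1)).mono fun N ⟨hN, hmono⟩ => hN.trans (hmono 0 ⊤ le_top)
  have h8 : HasGroundStateBEC v (8 * (ρ / 8)) := hD v hv (ρ / 8) hρ' ⟨c, hc, key⟩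
  have e : (8 : ℝ) * (ρ / 8) = ρ := by ring
  exact e ▸ h8

end Summit.AtomisticToContinuum.BoseEinsteinCondensation.Cruxes.BoundaryTransferWeak.RimSqueeze

end
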